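import Summits.ABC.StewartYu.PadicG3TwoBasisStepR
import Summits.ABC.StewartYu.PadicG3TwoMainChainSat
import HarnessLib

/-!
# Cell abc-stewartyu, WP-L.P(2) (crux r4 `PadicCoreTwoRat`, stmt-ABC-20504), assembly layer: the BASIS STEP of the
# 𝔑-THREADED frame — the shape predicate `ShFeldSat` (pre-scaled Fel'dman basis, level-`0` coordinates AND virtual
# box, base-relative exponents) and `BasisStepTwoR σ (ShSat F Bv (ShFeldSat …)) I`

`Summits/ABC/StewartYu/PadicG3TwoBasisStepSat.lean` — cell `abc-stewartyu` (HOME `run/shared/lean/pub/abc-stewartyu/`),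
route `YuMatveevShapeRat`, seat p3 (g9, WP-L.P(2) lead; design memo HOME/p3/memo-11 §2 rows «levels» / «third step»).
One shape predicate and theorems; no named fact.  Twin of p5's `PadicG3TwoBasisStepR.basisStepTwoR_feld` (v2, base point).

In the 𝔑-threaded frame the unknowns are indexed by `i = (ℓ, κ)` with `κ ∈ ℤ^{d+1}` the ϑ-coordinates of a member of
the LEVEL-`0` family (the image `λ ᵥ* C` of the α-box, so `κ ᵥ* U = N·λ`); at level `I` the exponent vectors are
`κᵢ⁽ᴵ⁾ = (κ − c)/3^I` for a common base point `c` of the level-`0` family (`reindex3R`).  The shape predicate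
**`ShFeldSat σ F Bv₀ I* H L₀`** = the landed `ShFeldR σ I* H L₀` (degrees, `Rᵢ = Δ(3^{I*−I}Y₀; ℓ, H)`, level-`0`
COORDINATE box, base-point identity) ∧ the level-`0` VIRTUAL box of every member AND of the base point
(`|(κ ᵥ* U)ⱼ|, |(c ᵥ* U)ⱼ| ≤ Bv₀ⱼ`).  From it:

* `vbox_of_shFeldSat` — at level `I` the virtual box is `2·Bv₀/3^I` (integer division): the first component of
  `ShSat F Bv …` whenever `2·Bv₀ⱼ/3^I ≤ Bv I j`;
* **`basisStepTwoR_feldSat`** — `BasisStepTwoR σ (ShSat F Bv (ShFeldSat σ F Bv₀ I* H L₀)) I` for `I + 1 ≤ I*` from the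
  `Y₀`-weight lines of level `I + 1`, the coordinate box slots `2·Dbox 0 j/3^{I+1} ≤ Dbox (I+1) j`,
  `2·Dθ 0/3^{I+1} ≤ Dθ (I+1)` and the virtual slot `2·Bv₀ⱼ/3^{I+1} ≤ Bv (I+1) j`.

WHAT THIS IS NOT: no level `0` (sequel: Siegel on the C-image family), no numbers; no crux moves (A1.L not moved).

References: Yu. V. Nesterenko, LNM 1819 (2003), §3.1 Prop 3.1, §4.3 (4.35), (4.45); K. Yu, Acta Math. 211 (2013),
Lemma 5.4 and (5.1)(i); HOME/p3/memo-11 §2.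
-/

noncomputable section

open Finset Polynomial
open scoped Matrix
open Literature.NumberTheory.Transcendental
open Literature.NumberTheory.Transcendental (FeldmanDelta.den)
open Literature.NumberTheory.Transcendental.FeldmanDelta
open Literature.NumberTheory.Transcendental.CW77.Setup (Tau tauNorm)

namespace Summit.ABC.StewartYu

namespace TwoSetup

open Summit.ABC.StewartYu.FeldmanBasis Summit.ABC.StewartYu.G3Boxes

variable {S : TwoSetup} (σ : S.G3TwoSched) (F : S.SatData) (Bv₀ : Fin (S.d + 1) → ℕ)

/-- **The shape predicate of the 𝔑-threaded frame with the common base point**: the landed `ShFeldR σ I* H L₀ I Λ`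
together with the level-`0` VIRTUAL box of every member and of the base point. [cite: Nesterenko2003, §4.3 (4.35); shape only] -/
def ShFeldSat (Istar H L₀ : ℕ) (I : ℕ) (Λ : S.G3Fam (ℕ × ((Fin S.d → ℤ) × ℤ))) : Prop :=
  ShFeldR σ Istar H L₀ I Λ ∧
  (∀ i ∈ Λ.B, ∀ j, |((Fin.snoc i.2.1 i.2.2 : Fin (S.d + 1) → ℤ) ᵥ* F.U) j| ≤ (Bv₀ j : ℤ)) ∧
  ∃ (c : Fin S.d → ℤ) (cθ : ℤ), (∀ j, |((Fin.snoc c cθ : Fin (S.d + 1) → ℤ) ᵥ* F.U) j| ≤ (Bv₀ j : ℤ)) ∧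
    ∀ i ∈ Λ.B, (∀ j, 3 ^ I * Λ.u i j = i.2.1 j - c j) ∧ 3 ^ I * Λ.uθ i = i.2.2 - cθ

/-! ### The virtual box at level `I` from the base point -/

/-- `3^I·κ⁽ᴵ⁾ = κ − c` as vectors over all `d + 1` generators. [folklore] -/
theorem snoc_pow_mul_eq {I : ℕ} {u c : Fin S.d → ℤ} {uθ cθ : ℤ} {κ : (Fin S.d → ℤ) × ℤ}
    (h : (∀ j, 3 ^ I * u j = κ.1 j - c j) ∧ 3 ^ I * uθ = κ.2 - cθ) :
    (3 : ℤ) ^ I • (Fin.snoc u uθ : Fin (S.d + 1) → ℤ) =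
      (Fin.snoc κ.1 κ.2 : Fin (S.d + 1) → ℤ) - Fin.snoc c cθ := by
  funext k
  simp only [Pi.smul_apply, Pi.sub_apply, smul_eq_mul]
  refine Fin.lastCases ?_ (fun j => ?_) k
  · simp only [Fin.snoc_last]; exact h.2
  · simp only [Fin.snoc_castSucc]; exact h.1 j

/-- From `3^I·v = a − b` with `|(a ᵥ* U)ⱼ|, |(b ᵥ* U)ⱼ| ≤ D`: `|(v ᵥ* U)ⱼ| ≤ 2D/3^I`. [folklore] -/
theorem abs_vecMul_le_of_pow_smul_eq {I : ℕ} {v a b : Fin (S.d + 1) → ℤ} (h : (3 : ℤ) ^ I • v = a - b)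
    {D : ℤ} (j : Fin (S.d + 1)) (ha : |(a ᵥ* F.U) j| ≤ D) (hb : |(b ᵥ* F.U) j| ≤ D) :
    |(v ᵥ* F.U) j| ≤ 2 * D / 3 ^ I := by
  have hv : 3 ^ I * (v ᵥ* F.U) j = (a ᵥ* F.U) j - (b ᵥ* F.U) j := by
    have := congrArg (fun w => (w ᵥ* F.U) j) h
    simp only [Matrix.smul_vecMul, Matrix.sub_vecMul, Pi.smul_apply, Pi.sub_apply, smul_eq_mul] at this
    exact this
  exact abs_le_two_mul_div_of_pow_mul_eq hv ha hb

/-- **The virtual box at level `I`**: under `ShFeldSat`, every exponent vector has `|(κᵢ⁽ᴵ⁾ ᵥ* U)ⱼ| ≤ 2·Bv₀ⱼ/3^I`.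
[cite: Nesterenko2003, §4.3 (4.35); shape only] -/
theorem vbox_of_shFeldSat {Istar H L₀ I : ℕ} {Λ : S.G3Fam (ℕ × ((Fin S.d → ℤ) × ℤ))}
    (h : ShFeldSat σ F Bv₀ Istar H L₀ I Λ) :
    ∀ i ∈ Λ.B, ∀ j, |(S.allκ Λ.u Λ.uθ i ᵥ* F.U) j| ≤ 2 * (Bv₀ j : ℤ) / 3 ^ I := by
  obtain ⟨_, hv, c, cθ, hc, hbase⟩ := h
  intro i hi j
  exact abs_vecMul_le_of_pow_smul_eq F (snoc_pow_mul_eq (hbase i hi)) j (hv i hi j) (hc j)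

/-! ### The basis step -/

/-- **THE BASIS STEP OF THE 𝔑-THREADED FRAME at a level `I` with `I + 1 ≤ I*`**: `BasisStepTwoR` for the shape slot
`ShSat F Bv (ShFeldSat σ F Bv₀ I* H L₀)` from the `Y₀`-weight lines of level `I + 1`, the coordinate box slots and
the virtual slot `2·Bv₀ⱼ/3^{I+1} ≤ Bv (I+1) j`. [cite: Nesterenko2003, §3.1 Prop 3.1 and §4.3 (4.35), (4.45)] -/
theorem basisStepTwoR_feldSat (Bv : ℕ → Fin (S.d + 1) → ℕ) {H L₀ I : ℕ} (hH : 1 ≤ H) (hI : I + 1 ≤ σ.Istar)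
    (hden₀ : ∀ (x : ℤ) (τ : Tau S.d), σ.den₀ (I + 1) x τ = Nat.lcmUpto H ^ τ.1)
    (hM₀ : ∀ (x : ℤ) (τ : Tau S.d), ∀ ℓ, ℓ ≤ L₀ →
      (3 : ℝ) ^ ((σ.Istar - (I + 1)) * τ.1) * ((Nat.lcmUpto H : ℝ) ^ τ.1 *
        (Real.exp (H / Real.exp 1) *
          (Real.exp 1 * (1 + (3 : ℝ) ^ (σ.Istar - (I + 1)) * |(x : ℝ)| / H)) ^ ℓ)) ≤ σ.M₀ (I + 1) x τ)
    (hDbox : ∀ j, 2 * (σ.Dbox 0 j : ℤ) / 3 ^ (I + 1) ≤ (σ.Dbox (I + 1) j : ℤ))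
    (hDθ : 2 * (σ.Dθ 0 : ℤ) / 3 ^ (I + 1) ≤ (σ.Dθ (I + 1) : ℤ))
    (hBv : ∀ j, 2 * (Bv₀ j : ℤ) / 3 ^ (I + 1) ≤ (Bv (I + 1) j : ℤ)) :
    BasisStepTwoR σ (ShSat F Bv (ShFeldSat σ F Bv₀ σ.Istar H L₀)) I := by
  have hcomp : ∀ ℓ, (feldRs ℓ H (σ.Istar - I)).comp (C (3⁻¹ : ℚ) * X) = feldRs ℓ H (σ.Istar - (I + 1)) := by
    intro ℓ
    have e : σ.Istar - I = (σ.Istar - (I + 1)) + 1 := by omega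
    rw [e, feldRs_succ_comp_third]
  -- the new exponents times `3^{I+1}` are differences of original points
  have hdiff : ∀ Λ : S.G3Fam (ℕ × ((Fin S.d → ℤ) × ℤ)),
      S.G3Adm σ (ShSat F Bv (ShFeldSat σ F Bv₀ σ.Istar H L₀)) I Λ →
      ∀ i₁ ∈ Λ.B, ∀ i ∈ (Λ.reindex3R i₁).B,
        (∀ j, 3 ^ (I + 1) * (Λ.reindex3R i₁).u i j = i.2.1 j - i₁.2.1 j) ∧
          3 ^ (I + 1) * (Λ.reindex3R i₁).uθ i = i.2.2 - i₁.2.2 := by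
    intro Λ hadm i₁ hi₁ i hi
    obtain ⟨⟨_, c, cθ, _, _, hbase⟩, _, _⟩ := hadm.shape.2
    have hiB : i ∈ Λ.B := Λ.reindex3R_B_subset i₁ hi
    refine ⟨fun j => ?_, ?_⟩
    · have h3 := Λ.u_eq_of_memR i₁ hi j
      have e1 := (hbase i hiB).1 j
      have e2 := (hbase i₁ hi₁).1 j
      rw [pow_succ]
      linear_combination e1 - e2 - 3 ^ I * h3
    · have h3 := Λ.uθ_eq_of_memR i₁ hi
      have e1 := (hbase i hiB).2
      have e2 := (hbase i₁ hi₁).2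
      rw [pow_succ]
      linear_combination e1 - e2 - 3 ^ I * h3
  refine ⟨?_, ?_, ?_⟩
  · intro Λ hadm i hi x τ
    obtain ⟨hℓ, hR, _, _⟩ := hadm.shape.2.1.1 i hi
    rw [hR, hcomp, hden₀]
    exact exists_int_lcm_pow_mul_hasse_feldRs i.1 hH _ τ.1 x (hM₀ x τ i.1 hℓ)
  · intro Λ hadm i₁ hi₁ i hi
    have hiB : i ∈ Λ.B := Λ.reindex3R_B_subset i₁ hi
    obtain ⟨_, _, hbi, hbiθ⟩ := hadm.shape.2.1.1 i hiB
    obtain ⟨_, _, hb1, hb1θ⟩ := hadm.shape.2.1.1 i₁ hi₁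
    have hd := hdiff Λ hadm i₁ hi₁ i hi
    refine ⟨fun j => ?_, ?_⟩
    · exact (abs_le_two_mul_div_of_pow_mul_eq (hd.1 j) (hbi j) (hb1 j)).trans (hDbox j)
    · exact (abs_le_two_mul_div_of_pow_mul_eq hd.2 hbiθ hb1θ).trans hDθ
  · intro Λ hadm i₁ hi₁
    obtain ⟨⟨hsh, c, cθ, _, _, _⟩, hv, _, _, _, _⟩ := hadm.shape.2
    obtain ⟨_, _, hb1, hb1θ⟩ := hsh i₁ hi₁
    have hv1 := hv i₁ hi₁
    -- the new shape: base point `i₁.2`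
    have hshape' : ShFeldSat σ F Bv₀ σ.Istar H L₀ (I + 1) (Λ.reindex3R i₁) := by
      refine ⟨⟨fun i hi => ?_, i₁.2.1, i₁.2.2, hb1, hb1θ, fun i hi => hdiff Λ hadm i₁ hi₁ i hi⟩,
        fun i hi => hv i (Λ.reindex3R_B_subset i₁ hi), i₁.2.1, i₁.2.2, hv1,
        fun i hi => hdiff Λ hadm i₁ hi₁ i hi⟩
      have hiB : i ∈ Λ.B := Λ.reindex3R_B_subset i₁ hi
      obtain ⟨hℓ, hR, hbi, hbiθ⟩ := hsh i hiB
      refine ⟨hℓ, ?_, hbi, hbiθ⟩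
      change (Λ.R i).comp (C (3⁻¹ : ℚ) * X) = _
      rw [hR, hcomp]
    refine ⟨fun i hi j => ?_, hshape'⟩
    exact (vbox_of_shFeldSat σ F Bv₀ hshape' i hi j).trans (hBv j)

end TwoSetup

end Summit.ABC.StewartYu

end
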